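import Mathlib
import Summits.Ventures.LatticeQCDFlow.TrivializingMaps.TruncatedFlowLightCone
import HarnessLib

/-!
HONEST FRAMING: exact (Metropolis-corrected) sampling algorithms for lattice gauge theory; figures
of merit are autocorrelation/cost numbers at stated couplings and volumes; no continuum-physics
claim.

# TruncatedFlowReparamLightCone — the light cone of the order-`N` truncated Wilson flow under ANY time
# reparametrisation and either sign: the REVERSE flow (the inverse map) included (cell pub-lqcd, lean-2
# GEN-5)

`TruncatedFlowLightCone.lean` proves the volume-uniform light cone for flow maps of
`Z_t = -∂S̃^{[N]}_t`.  The flow-MCMC samplers of record also integrate the flow BACKWARDS (Lüscher §3.2: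
the inverse map `Φ₁⁻¹` is the time-one map of `Z'_s = +∂S̃^{[N]}_{1-s}`; tree `isTangent_linkGrad_rev`,
`contDiff_one_linkGrad_rev_param`), and a network emulating the sampler must emulate `Φ₁⁻¹` as well
(density evaluation at the current state).  The inputs `K_Z(T)`, `M_Z(T)` of THEOREM L only see
`|t| ≤ T`, so the cone survives any reparametrisation of time and either sign of the generator:

* `truncatedFlow_lightCone_reparam` — for `n ≠ 0`, `T ≥ 0`, a time profile `τ : ℝ → ℝ` with `|τ s| ≤ T`
  for `s ∈ [0, T')`, a sign `σ ∈ {1, -1}` (any real with `|σ| ≤ 1`), every smooth solution for `β·S_W`,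
  every flow map `Φ` of `s ↦ σ·∂S̃^{[N]}_{τ(s)}`, every level function 1-Lipschitz for the read sets and all
  `V, V'` agreeing at levels `≥ 1`:
  `‖Φ_s(V)_e - Φ_s(V')_e‖_F ≤ 2n e^{cs}(cs)^{lvl e}/(lvl e)!` on `[0, T']`, `c = coneRate d n B β T N`;
* `truncatedFlow_reverse_lightCone_ball` — the REVERSE FLOW `Z'_s = +∂S̃^{[N]}_{1-s}` on `[0, 1]`:
  `V = V'` on `linkBall (2(N+1)m) e₀` ⇒ `‖Φ'_s(V)_{e₀} - Φ'_s(V')_{e₀}‖_F ≤ 2n e^{cs}(cs)^m/m!`,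
  `c = coneRate d n B β 1 N` — the inverse map of the sampler is as local as the map, every volume.

NOT claimed: that a given `Φ'` IS the inverse of the forward flow (that is the uniqueness bookkeeping of
`TrivializingHomeomorph`/`FlowExistence`, not repeated here); any cost statement.

References: M. Lüscher, Commun. Math. Phys. 293 (2010) 899 [Luscher2010Trivializing], §3.2 ("integrating
the flow equation backwards in time"), §4.5(b); THEORY-1.md §26.
-/

noncomputable section

namespace Summit.Ventures.LatticeQCDFlow.TrivializingMaps

open Literature.MathematicalPhysics.QuantumFieldTheory
open Literature.MathematicalPhysics.QuantumFieldTheory.Luscher2010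
open Literature.MathematicalPhysics.QuantumFieldTheory.WilsonFlow (coeConfig)
open GradedSeries
open scoped Matrix Matrix.Norms.Frobenius Nat ContDiff

variable {d L n : ℕ} [NeZero L]

/-- **LIGHT CONE UNDER TIME REPARAMETRISATION AND SIGN.**  For `n ≠ 0`, `T ≥ 0`, a time profile `τ`
with `|τ s| ≤ T` on `[0, T')`, a scalar `σ` with `|σ| ≤ 1`, every smooth solution of Lüscher's recursion
for `β·S_W`, every flow map `Φ` of the generator `s ↦ σ · ∂S̃^{[N]}_{τ(s)}` (as the ambient field
`W ↦ σ • linkGrad B (truncFlowAction Sk (τ s) N) W`), every level function with `lvl e ≤ lvl e' + 1` on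
`linkBall (2(N+1)) e` and all `V, V'` agreeing at levels `≥ 1`:
`‖Φ_s(V)_e - Φ_s(V')_e‖_F ≤ 2n e^{cs}(cs)^{lvl e}/(lvl e)!` for `s ∈ [0, T']`, `c = coneRate d n B β T N`.
[ours; cf. Luscher2010Trivializing §3.2, §4.5(b)] -/
theorem truncatedFlow_lightCone_reparam (hn : n ≠ 0) (B : SuBasis n) (β : ℝ) (N : ℕ) {T : ℝ}
    (hT : 0 ≤ T) {Sk : ℕ → AmbConfig d L n → ℝ} {c : ℕ → ℝ} (hsm : ∀ k, ContDiff ℝ ∞ (Sk k))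
    (hser : IsLuscherSeries B (fun W => β * ambWilsonAction W) Sk c) {τ : ℝ → ℝ} {T' : ℝ}
    (hτ : ∀ s ∈ Set.Ico 0 T', |τ s| ≤ T) {σ : ℝ} (hσ : |σ| ≤ 1)
    {Φ : ℝ → GaugeConfig d L (Matrix.specialUnitaryGroup (Fin n) ℂ) →
      GaugeConfig d L (Matrix.specialUnitaryGroup (Fin n) ℂ)}
    (hΦ : IsFlowMap (fun s W => (σ : ℂ) • linkGrad B (truncFlowAction Sk (τ s) N) W) Φ)
    (lvl : Edge d L → ℕ) (hlvl : ∀ e, ∀ e' ∈ linkBall (2 * (N + 1)) e, lvl e ≤ lvl e' + 1)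
    (V V' : GaugeConfig d L (Matrix.specialUnitaryGroup (Fin n) ℂ))
    (hVV' : ∀ e, 1 ≤ lvl e → V e = V' e) :
    ∀ s ∈ Set.Icc 0 T', ∀ e, ‖coeConfig (Φ s V) e - coeConfig (Φ s V') e‖ ≤
      2 * n * Real.exp (coneRate d n B β T N * s) *
        (coneRate d n B β T N * s) ^ (lvl e) / ((lvl e)! : ℝ) := by
  have hgen : ∀ (s : ℝ) (U : GaugeConfig d L (Matrix.specialUnitaryGroup (Fin n) ℂ)) (e : Edge d L),
      linkGrad B (truncFlowAction Sk s N) (coeConfig U) e =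
        linkGrad B (truncFlowAction (fun k W => β ^ (k + 1) * gradedSk (d := d) (L := L) B k W) s N)
          (coeConfig U) e := fun s U e => linkGrad_truncFlowAction_eq_smul_gradedSk B β hsm hser s N U e
  have hσ1 : ‖(σ : ℂ)‖ ≤ 1 := by rw [Complex.norm_real, Real.norm_eq_abs]; exact hσ
  have h := IsFlowMap.lightConeOn hΦ (fun e => linkBall (2 * (N + 1)) e) (fun e => self_mem_linkBall _ e)
    lvl hlvl (KZ_nonneg d n B β hT N) (MZ_nonneg d n B β hT N) T' ?_ ?_ V V' hVV'
  · simpa only [coneRate] using h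
  · intro s hs U U' e M hM hUU'
    simp only [Pi.smul_apply]
    rw [← smul_sub, norm_smul, hgen (τ s) U e, hgen (τ s) U' e]
    have hK := (norm_linkGrad_truncFlowAction_smul_gradedSk_sub_le_of_linkBall B hn β (τ s) N e U U'
      hM hUU').trans (mul_le_mul_of_nonneg_right (mul_le_mul_of_nonneg_right
        (lipschitzSum_le_of_abs_le B (hτ s hs) β N) (Finset.sum_nonneg fun a _ => norm_nonneg _)) hM)
    have hK0 : 0 ≤ KZ d n B β T N * M := mul_nonneg (KZ_nonneg d n B β hT N) hM
    calc ‖(σ : ℂ)‖ * ‖linkGrad B (truncFlowAction (fun k W => β ^ (k + 1) *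
            gradedSk (d := d) (L := L) B k W) (τ s) N) (coeConfig U) e -
          linkGrad B (truncFlowAction (fun k W => β ^ (k + 1) *
            gradedSk (d := d) (L := L) B k W) (τ s) N) (coeConfig U') e‖
        ≤ 1 * (KZ d n B β T N * M) := mul_le_mul hσ1 hK (norm_nonneg _) zero_le_one
      _ = KZ d n B β T N * M := one_mul _
  · intro s hs U e
    simp only [Pi.smul_apply]
    rw [norm_smul, hgen (τ s) U e]
    have hB := norm_linkGrad_truncFlowAction_smul_gradedSk_le_of_abs_le B hn β (hτ s hs) N U e
    calc ‖(σ : ℂ)‖ * ‖linkGrad B (truncFlowAction (fun k W => β ^ (k + 1) *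
            gradedSk (d := d) (L := L) B k W) (τ s) N) (coeConfig U) e‖
        ≤ 1 * MZ d n B β T N := mul_le_mul hσ1 hB (norm_nonneg _) zero_le_one
      _ = MZ d n B β T N := one_mul _

/-- **THE REVERSE FLOW (INVERSE MAP) HAS THE SAME LIGHT CONE.**  For `n ≠ 0`, every smooth solution for
`β·S_W`, every flow map `Φ'` of the time-reversed generator `Z'_s = +∂S̃^{[N]}_{1-s}` (Lüscher §3.2;
its time-one map inverts the sampler's `Φ₁`), every `m` and all `V, V'` agreeing on
`linkBall (2(N+1)·m) e₀`: `‖Φ'_s(V)_{e₀} - Φ'_s(V')_{e₀}‖_F ≤ 2n e^{cs}(cs)^m/m!` for `s ∈ [0, 1]`,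
`c = coneRate d n B β 1 N` — volume-free. [ours; cf. Luscher2010Trivializing §3.2] -/
theorem truncatedFlow_reverse_lightCone_ball (hn : n ≠ 0) (B : SuBasis n) (β : ℝ) (N : ℕ)
    {Sk : ℕ → AmbConfig d L n → ℝ} {c : ℕ → ℝ} (hsm : ∀ k, ContDiff ℝ ∞ (Sk k))
    (hser : IsLuscherSeries B (fun W => β * ambWilsonAction W) Sk c)
    {Φ' : ℝ → GaugeConfig d L (Matrix.specialUnitaryGroup (Fin n) ℂ) →
      GaugeConfig d L (Matrix.specialUnitaryGroup (Fin n) ℂ)}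
    (hΦ' : IsFlowMap (fun s W => linkGrad B (truncFlowAction Sk (1 - s) N) W) Φ')
    (e₀ : Edge d L) (m : ℕ) (V V' : GaugeConfig d L (Matrix.specialUnitaryGroup (Fin n) ℂ))
    (hVV' : ∀ e ∈ linkBall (2 * (N + 1) * m) e₀, V e = V' e) :
    ∀ s ∈ Set.Icc (0 : ℝ) 1, ‖coeConfig (Φ' s V) e₀ - coeConfig (Φ' s V') e₀‖ ≤
      2 * n * Real.exp (coneRate d n B β 1 N * s) * (coneRate d n B β 1 N * s) ^ m / (m ! : ℝ) := by
  intro s hs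
  have hΦ1 : IsFlowMap (fun s W => ((1 : ℝ) : ℂ) • linkGrad B (truncFlowAction Sk (1 - s) N) W) Φ' := by
    simpa only [Complex.ofReal_one, one_smul] using hΦ'
  have hτ : ∀ s ∈ Set.Ico (0 : ℝ) 1, |1 - s| ≤ 1 := fun s hs => by
    rw [abs_le]; constructor <;> linarith [hs.1, hs.2]
  have h := truncatedFlow_lightCone_reparam hn B β N zero_le_one hsm hser hτ (σ := 1)
    (by rw [abs_one]) hΦ1 (ballLevel (2 * (N + 1)) m e₀)
    (fun e e' he' => ballLevel_le_succ (2 * (N + 1)) m e₀ e he') V V'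
    (fun e he => hVV' e (mem_linkBall_of_ballLevel_pos he)) s hs e₀
  rwa [ballLevel_self] at h

end Summit.Ventures.LatticeQCDFlow.TrivializingMaps

end
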